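import Summits.KontsevichZagierPeriods.KontsevichZagierPeriods.Theses.InverseLandau
import Summits.KontsevichZagierPeriods.KontsevichZagierPeriods.Theorems.InverseLandauFiveTermCertificateLoops
import Literature.NumberTheory.Transcendental.KZProductIdeal
import Literature.NumberTheory.Transcendental.KZDominatedFamilyRelations

/-!
# `FiveTermCertificate` (stmt-KontsevichZagierPeriods-13875): Abel's five-term identity in `KZ.relations`

The support item `InverseLandau.FiveTermCertificate`: for real algebraic `x, y` with `0 < x`,
`0 < y`, `x + y < 1`, every Kontsevich–Zagier integral representation on the open square `(0,1)²`
with the five-term integrand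
`a₃/(1−a₃z₀z₁) + a₄/(1−a₄z₀z₁) − a₁/(1−a₁z₀z₁) − a₂/(1−a₂z₀z₁) − a₅/(1−a₅z₀z₁) − x/(1−xz₀)·y/(1−yz₁)`
(`a₁ = x, a₂ = y, a₃ = x/(1−y), a₄ = y/(1−x), a₅ = xy/((1−x)(1−y))`; value
`Li₂(a₃) + Li₂(a₄) − Li₂(a₁) − Li₂(a₂) − Li₂(a₅) − log(1−x)log(1−y) = 0`, Abel's identity) lies in
`KZ.relations`.

The certificate (a chain of moves, no numerics; names as in the glossary of
`InverseLandauFiveTermCertificateKit.lean`): on the closed cube `[0,1]³` the five-term integrand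
`abelF(c₀,c₁)` equals the sum of the three Stokes elements of `−tatePhi` (along the Tate homotopy
coordinate `w = c₂`: `tatePhi|_{w=1} = abelF`, `tatePhi|_{w=0} = 0`), `tateB` (along `z₁ = c₁`) and
`tateA` (along `z₀ = c₀`) plus the weight-one remainder `gOne(c₀,c₂) + gTwo(c₁,c₂)` (weight drop
`∂_w tatePhi = ∂_{z₁}tateB + ∂_{z₀}tateA`); the Stokes part is a relation by the Stokes span
calibration (`SectorToKernel.stub_stokesSpanCalibration`), `[gTwo(c₁,c₂)] ∼ [gTwo(c₀,c₂)]` by the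
coordinate transposition (`KZ.of_sub_of_reindex_mem_relations`), and `[gOne(c₀,c₂) + gTwo(c₀,c₂)]` is
a relation by the two parametrised loop certificates (`of_weightOne_mem_relations`). Finally
`[[0,1]³, abelF ∘ (c₀,c₁)] ∼ [[0,1]², abelF]` (a slab Newton–Leibniz move), the closed and open
squares differ by a null set, and the item's integrand agrees with `abelF` on the open square.

References: D. Zagier, *The dilogarithm function* (2007), Ch. I §2; M. Kontsevich, D. Zagier,
*Periods* (2001), §1.2; J. Ayoub, *Periods and the conjectures of Grothendieck and
Kontsevich–Zagier* (2014), Def. 10.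
-/

noncomputable section

namespace Summit.KontsevichZagierPeriods.InverseLandau.FiveTerm

open Set MeasureTheory
open Literature.NumberTheory.Transcendental
open Literature.NumberTheory.Transcendental.KZ
open Literature.ModelTheory.ExponentialFields (IsSemialgebraic)
open Summit.KontsevichZagierPeriods.FurushoPentagon.SectorToKernel (stub_stokesSpanCalibration)
open Summit.KontsevichZagierPeriods.KontsevichZagierPeriods.Theses.InverseLandau (FiveTermCertificate)

/-! ## The homotopy stage: Stokes elements of `−tatePhi`, `tateB`, `tateA` -/

/-- **Tate homotopy and weight drop as one Stokes-span relation.** For real algebraic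
`0 < x, 0 < y, x + y < 1`, the tame cube representation
`[[0,1]³, abelF(c₀,c₁) − gOne(c₀,c₂) − gTwo(c₁,c₂)]` lies in `KZ.relations`: the integrand is the sum
of the Stokes elements of `−tatePhi` along `c₂`, `tateB` along `c₁` and `tateA` along `c₀`
(`∂_w tatePhi = tateBz + tateAz`, `tatePhi|₁ = abelF`, `tatePhi|₀ = 0`, `tateB|_{z₁=1} = gOne`,
`tateB|_{z₁=0} = 0`, `tateA|_{z₀=1} = gTwo`, `tateA|_{z₀=0} = 0`).
[Kontsevich–Zagier 2001, §1.2 rule (3); Zagier 2007, Ch. I §2] -/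
theorem of_homotopyStage_mem_relations {x y : ℝ} (hxa : IsAlgebraic ℚ x) (hya : IsAlgebraic ℚ y)
    (hx : 0 < x) (hy : 0 < y) (hxy : x + y < 1)
    (hA : AnalyticOnNhd ℝ (fun c : Fin 3 → ℝ =>
      (x / ((1 - y) - x * (c 0) * (c 1)) + y / ((1 - x) - y * (c 0) * (c 1)) - x / (1 - x * (c 0) * (c 1)) - y / (1 - y * (c 0) * (c 1)) - x * y / ((1 - x) * (1 - y) - x * y * (c 0) * (c 1)) - x / (1 - x * (c 0)) * (y / (1 - y * (c 1)))) - ((x * 1 / ((1 - y) - (x * (c 2) * (c 0)) * 1) + (x * y / (1 - x * (c 2))) * 1 / ((1 - x * (c 2)) - (y * (c 0)) * 1) - x * 1 / (1 - (x * (c 2) * (c 0)) * 1) - (x * y / (1 - x * (c 2))) * 1 / ((1 - x * (c 2)) * (1 - y) - (x * (c 2) * y * (c 0)) * 1))) - ((-(x * 1 / (1 - (x * (c 2)) * 1) * (y / (1 - y * (c 1))))))) (KZ.cube 3))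
    (hS : IsSemialgebraicFunOn ℚ (KZ.cube 3) (fun c : Fin 3 → ℝ =>
      (x / ((1 - y) - x * (c 0) * (c 1)) + y / ((1 - x) - y * (c 0) * (c 1)) - x / (1 - x * (c 0) * (c 1)) - y / (1 - y * (c 0) * (c 1)) - x * y / ((1 - x) * (1 - y) - x * y * (c 0) * (c 1)) - x / (1 - x * (c 0)) * (y / (1 - y * (c 1)))) - ((x * 1 / ((1 - y) - (x * (c 2) * (c 0)) * 1) + (x * y / (1 - x * (c 2))) * 1 / ((1 - x * (c 2)) - (y * (c 0)) * 1) - x * 1 / (1 - (x * (c 2) * (c 0)) * 1) - (x * y / (1 - x * (c 2))) * 1 / ((1 - x * (c 2)) * (1 - y) - (x * (c 2) * y * (c 0)) * 1))) - ((-(x * 1 / (1 - (x * (c 2)) * 1) * (y / (1 - y * (c 1)))))))) :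
    of (IntegralRep.tameCube _ hA hS) ∈ relations := by
  obtain ⟨H0, hH0⟩ : ∃ H : (Fin 3 → ℝ) → ℝ, H = fun c => -(x * (c 2) / ((1 - y) - (x * (c 0) * (c 1)) * (c 2)) + y / ((1 - y * (c 0) * (c 1)) - x * (c 2)) - x * (c 2) / (1 - (x * (c 0) * (c 1)) * (c 2)) - y / (1 - y * (c 0) * (c 1)) - (x * y) * (c 2) / ((1 - y) - (x * (1 - y) + x * y * (c 0) * (c 1)) * (c 2)) - x * (c 2) / (1 - (x * (c 0)) * (c 2)) * (y / (1 - y * (c 1)))) := ⟨_, rfl⟩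
  obtain ⟨H1, hH1⟩ : ∃ H : (Fin 3 → ℝ) → ℝ, H = fun c => (x * (c 1) / ((1 - y) - (x * (c 2) * (c 0)) * (c 1)) + (x * y / (1 - x * (c 2))) * (c 1) / ((1 - x * (c 2)) - (y * (c 0)) * (c 1)) - x * (c 1) / (1 - (x * (c 2) * (c 0)) * (c 1)) - (x * y / (1 - x * (c 2))) * (c 1) / ((1 - x * (c 2)) * (1 - y) - (x * (c 2) * y * (c 0)) * (c 1))) := ⟨_, rfl⟩
  obtain ⟨H2, hH2⟩ : ∃ H : (Fin 3 → ℝ) → ℝ, H = fun c => (-(x * (c 0) / (1 - (x * (c 2)) * (c 0)) * (y / (1 - y * (c 1))))) := ⟨_, rfl⟩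
  have hH0a : AnalyticOnNhd ℝ H0 (KZ.cube 3) := by
    rw [hH0]; exact fun z hz => an_neg (an_tatePhi hx hy hxy z hz)
  have hH1a : AnalyticOnNhd ℝ H1 (KZ.cube 3) := by rw [hH1]; exact an_tateB hx hy hxy
  have hH2a : AnalyticOnNhd ℝ H2 (KZ.cube 3) := by rw [hH2]; exact an_tateA hx hy hxy
  have hH0s : IsSemialgebraicFunOn ℚ (KZ.cube 3) H0 := by rw [hH0]; exact (sa_tatePhi hxa hya).fun_neg
  have hH1s : IsSemialgebraicFunOn ℚ (KZ.cube 3) H1 := by rw [hH1]; exact sa_tateB hxa hya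
  have hH2s : IsSemialgebraicFunOn ℚ (KZ.cube 3) H2 := by rw [hH2]; exact sa_tateA hxa hya
  refine stub_stokesSpanCalibration 3 _ rfl 3 ![2, 1, 0] ![H0, H1, H2] ?_ ?_
  · intro j
    fin_cases j
    · exact ⟨hH0a, hH0s⟩
    · exact ⟨hH1a, hH1s⟩
    · exact ⟨hH2a, hH2s⟩
  intro z hz
  obtain ⟨f01, f02, f03, f04, f05, f06, f07, f08, f09, f10, f11, f12, f13, f14, f15, f16, f17, f18,
    f19, f20, f21, f22, f23, f24, f25⟩ := facts hx hy hxy (mem_Icc_of_mem_cube hz 0)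
    (mem_Icc_of_mem_cube hz 1) (mem_Icc_of_mem_cube hz 2)
  have fin3_ne01 : (0 : Fin 3) ≠ 1 := by decide
  have fin3_ne02 : (0 : Fin 3) ≠ 2 := by decide
  have fin3_ne10 : (1 : Fin 3) ≠ 0 := by decide
  have fin3_ne12 : (1 : Fin 3) ≠ 2 := by decide
  have fin3_ne20 : (2 : Fin 3) ≠ 0 := by decide
  have fin3_ne21 : (2 : Fin 3) ≠ 1 := by decide
  have e0 : fderiv ℝ H0 z (Pi.single 2 1) =
      -((x * (1 - y) / ((1 - y) - (x * (z 2) * (z 0)) * (z 1)) ^ 2 + x * y / ((1 - x * (z 2)) - (y * (z 0)) * (z 1)) ^ 2 - x / (1 - (x * (z 2) * (z 0)) * (z 1)) ^ 2 - x * y * (1 - y) / ((1 - x * (z 2)) * (1 - y) - (x * (z 2) * y * (z 0)) * (z 1)) ^ 2) + (-(x / (1 - (x * (z 2)) * (z 0)) ^ 2 * (y / (1 - y * (z 1)))))) := by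
    refine fderiv_apply_single_eq 2 ((hH0a z hz).differentiableAt) ?_
    rw [hH0]
    simp only [Function.update_self, Function.update_of_ne fin3_ne02, Function.update_of_ne fin3_ne12]
    exact (hasDerivAt_tatePhi x y (z 0) (z 1) (z 2) f10.ne' f11.ne' f12.ne' f14.ne' f15.ne').neg
  have e1 : fderiv ℝ H1 z (Pi.single 1 1) = (x * (1 - y) / ((1 - y) - (x * (z 2) * (z 0)) * (z 1)) ^ 2 + x * y / ((1 - x * (z 2)) - (y * (z 0)) * (z 1)) ^ 2 - x / (1 - (x * (z 2) * (z 0)) * (z 1)) ^ 2 - x * y * (1 - y) / ((1 - x * (z 2)) * (1 - y) - (x * (z 2) * y * (z 0)) * (z 1)) ^ 2) := by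
    refine fderiv_apply_single_eq 1 ((hH1a z hz).differentiableAt) ?_
    rw [hH1]
    simp only [Function.update_self, Function.update_of_ne fin3_ne01, Function.update_of_ne fin3_ne21]
    exact hasDerivAt_tateB x y (z 0) (z 1) (z 2) f03.ne' f16.ne' f17.ne' f18.ne' f19.ne'
  have e2 : fderiv ℝ H2 z (Pi.single 0 1) = (-(x / (1 - (x * (z 2)) * (z 0)) ^ 2 * (y / (1 - y * (z 1))))) := by
    refine fderiv_apply_single_eq 0 ((hH2a z hz).differentiableAt) ?_
    rw [hH2]
    simp only [Function.update_self, Function.update_of_ne fin3_ne10, Function.update_of_ne fin3_ne20]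
    exact hasDerivAt_tateA x y (z 0) (z 1) (z 2) f20.ne'
  simp only [Fin.sum_univ_three, Matrix.cons_val_zero, Matrix.cons_val_one, Matrix.cons_val_two,
    Matrix.head_cons, Matrix.tail_cons, IntegralRep.tameCube_integrand]
  rw [e0, e1, e2, hH0, hH1, hH2]
  simp only [Function.update_self, Function.update_of_ne fin3_ne02, Function.update_of_ne fin3_ne12,
    Function.update_of_ne fin3_ne01, Function.update_of_ne fin3_ne21, Function.update_of_ne fin3_ne10,
    Function.update_of_ne fin3_ne20]
  ring

/-! ## The five-term cube representation is a relation -/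

/-- The coordinate transposition `(c₀ c₁)` maps the cube to itself. [folklore] -/
theorem setOf_swap_mem_cube :
    {w : Fin 3 → ℝ | (fun i => w ((Equiv.swap (0 : Fin 3) 1) i)) ∈ KZ.cube 3} = KZ.cube 3 := by
  ext w
  simp only [mem_setOf_eq, KZ.mem_cube]
  constructor
  · intro h i
    simpa [Equiv.swap_apply_self] using h ((Equiv.swap (0 : Fin 3) 1) i)
  · intro h i
    exact h _

/-- **The five-term integrand on the cube is a KZ relation.** `[[0,1]³, abelF(c₀,c₁)] ∈ relations`:
integrand additivity splits it into the homotopy stage (`of_homotopyStage_mem_relations`),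
`[gOne(c₀,c₂)]` and `[gTwo(c₁,c₂)]`; the transposition `(c₀ c₁)` (a change of variables,
`KZ.of_sub_of_reindex_mem_relations`) turns the last into `[gTwo(c₀,c₂)]`, and
`[gOne(c₀,c₂) + gTwo(c₀,c₂)]` is a relation (`of_weightOne_mem_relations`).
[Kontsevich–Zagier 2001, §1.2 rules (1)–(3)] -/
theorem of_abelF_cube_mem_relations {x y : ℝ} (hxa : IsAlgebraic ℚ x) (hya : IsAlgebraic ℚ y)
    (hx : 0 < x) (hy : 0 < y) (hxy : x + y < 1) :
    of (IntegralRep.tameCube (fun c : Fin 3 → ℝ => (x / ((1 - y) - x * (c 0) * (c 1)) + y / ((1 - x) - y * (c 0) * (c 1)) - x / (1 - x * (c 0) * (c 1)) - y / (1 - y * (c 0) * (c 1)) - x * y / ((1 - x) * (1 - y) - x * y * (c 0) * (c 1)) - x / (1 - x * (c 0)) * (y / (1 - y * (c 1))))) (an_abelF3 hx hy hxy)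
      (sa_abelF3 hxa hya)) ∈ relations := by
  -- the representations
  have hC : IsSemialgebraic ℚ (KZ.cube 3) := KZ.isSemialgebraic_cube
  set R3 := IntegralRep.tameCube (fun c : Fin 3 → ℝ => (x / ((1 - y) - x * (c 0) * (c 1)) + y / ((1 - x) - y * (c 0) * (c 1)) - x / (1 - x * (c 0) * (c 1)) - y / (1 - y * (c 0) * (c 1)) - x * y / ((1 - x) * (1 - y) - x * y * (c 0) * (c 1)) - x / (1 - x * (c 0)) * (y / (1 - y * (c 1))))) (an_abelF3 hx hy hxy)
    (sa_abelF3 hxa hya) with hR3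
  set T1 := IntegralRep.tameCube (fun c : Fin 3 → ℝ =>
      (x / ((1 - y) - x * (c 0) * (c 1)) + y / ((1 - x) - y * (c 0) * (c 1)) - x / (1 - x * (c 0) * (c 1)) - y / (1 - y * (c 0) * (c 1)) - x * y / ((1 - x) * (1 - y) - x * y * (c 0) * (c 1)) - x / (1 - x * (c 0)) * (y / (1 - y * (c 1)))) - ((x * 1 / ((1 - y) - (x * (c 2) * (c 0)) * 1) + (x * y / (1 - x * (c 2))) * 1 / ((1 - x * (c 2)) - (y * (c 0)) * 1) - x * 1 / (1 - (x * (c 2) * (c 0)) * 1) - (x * y / (1 - x * (c 2))) * 1 / ((1 - x * (c 2)) * (1 - y) - (x * (c 2) * y * (c 0)) * 1))) - ((-(x * 1 / (1 - (x * (c 2)) * 1) * (y / (1 - y * (c 1)))))))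
    (fun z hz => an_sub (an_sub (an_abelF3 hx hy hxy z hz) (an_gOne hx hy hxy z hz))
      (an_gTwo12 hx hy hxy z hz))
    (((sa_abelF3 hxa hya).fun_sub (sa_gOne hxa hya)).fun_sub (sa_gTwo hxa hya 1)) with hT1
  set Rr := IntegralRep.tameCube (fun c : Fin 3 → ℝ => ((x * 1 / ((1 - y) - (x * (c 2) * (c 0)) * 1) + (x * y / (1 - x * (c 2))) * 1 / ((1 - x * (c 2)) - (y * (c 0)) * 1) - x * 1 / (1 - (x * (c 2) * (c 0)) * 1) - (x * y / (1 - x * (c 2))) * 1 / ((1 - x * (c 2)) * (1 - y) - (x * (c 2) * y * (c 0)) * 1))) + ((-(x * 1 / (1 - (x * (c 2)) * 1) * (y / (1 - y * (c 1)))))))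
    (fun z hz => an_add (an_gOne hx hy hxy z hz) (an_gTwo12 hx hy hxy z hz))
    ((sa_gOne hxa hya).fun_add (sa_gTwo hxa hya 1)) with hRr
  set G1 := IntegralRep.tameCube (fun c : Fin 3 → ℝ => ((x * 1 / ((1 - y) - (x * (c 2) * (c 0)) * 1) + (x * y / (1 - x * (c 2))) * 1 / ((1 - x * (c 2)) - (y * (c 0)) * 1) - x * 1 / (1 - (x * (c 2) * (c 0)) * 1) - (x * y / (1 - x * (c 2))) * 1 / ((1 - x * (c 2)) * (1 - y) - (x * (c 2) * y * (c 0)) * 1)))) (an_gOne hx hy hxy)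
    (sa_gOne hxa hya) with hG1
  set G2' := IntegralRep.tameCube (fun c : Fin 3 → ℝ => ((-(x * 1 / (1 - (x * (c 2)) * 1) * (y / (1 - y * (c 1))))))) (an_gTwo12 hx hy hxy)
    (sa_gTwo hxa hya 1) with hG2'
  set G2 := IntegralRep.tameCube (fun c : Fin 3 → ℝ => ((-(x * 1 / (1 - (x * (c 2)) * 1) * (y / (1 - y * (c 0))))))) (an_gTwo02 hx hy hxy)
    (sa_gTwo hxa hya 0) with hG2
  set T2 := IntegralRep.tameCube (fun c : Fin 3 → ℝ => ((x * 1 / ((1 - y) - (x * (c 2) * (c 0)) * 1) + (x * y / (1 - x * (c 2))) * 1 / ((1 - x * (c 2)) - (y * (c 0)) * 1) - x * 1 / (1 - (x * (c 2) * (c 0)) * 1) - (x * y / (1 - x * (c 2))) * 1 / ((1 - x * (c 2)) * (1 - y) - (x * (c 2) * y * (c 0)) * 1))) + ((-(x * 1 / (1 - (x * (c 2)) * 1) * (y / (1 - y * (c 0)))))))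
    (fun z hz => an_add (an_gOne hx hy hxy z hz) (an_gTwo02 hx hy hxy z hz))
    ((sa_gOne hxa hya).fun_add (sa_gTwo hxa hya 0)) with hT2
  -- the two Stokes-span relations
  have hT1r : of T1 ∈ relations := of_homotopyStage_mem_relations hxa hya hx hy hxy _ _
  have hT2r : of T2 ∈ relations := of_weightOne_mem_relations hxa hya hx hy hxy _ _
  -- integrand additivity
  have a1 : of R3 - of T1 - of Rr ∈ relations := by
    refine integrandAddRel_subset_relations ⟨3, R3, T1, Rr, rfl, rfl, fun c _ => ?_, rfl⟩
    simp only [hR3, hT1, hRr, IntegralRep.tameCube_integrand, Pi.add_apply]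
    ring
  have a2 : of Rr - of G1 - of G2' ∈ relations := by
    refine integrandAddRel_subset_relations ⟨3, Rr, G1, G2', rfl, rfl, fun c _ => ?_, rfl⟩
    simp only [hRr, hG1, hG2', IntegralRep.tameCube_integrand, Pi.add_apply]
  have a5 : of T2 - of G1 - of G2 ∈ relations := by
    refine integrandAddRel_subset_relations ⟨3, T2, G1, G2, rfl, rfl, fun c _ => ?_, rfl⟩
    simp only [hT2, hG1, hG2, IntegralRep.tameCube_integrand, Pi.add_apply]
  -- the transposition `(c₀ c₁)`
  have a3 : of G2' - of (G2'.reindex (Equiv.swap (0 : Fin 3) 1)) ∈ relations :=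
    of_sub_of_reindex_mem_relations _ _
  have a4 : of (G2'.reindex (Equiv.swap (0 : Fin 3) 1)) - of G2 ∈ relations := by
    refine of_sub_of_mem_relations_of_eqOn ?_ fun w _ => ?_
    · rw [hG2, IntegralRep.tameCube_domain, IntegralRep.reindex_domain, hG2',
        IntegralRep.tameCube_domain, setOf_swap_mem_cube]
    · simp [hG2', hG2, Equiv.swap_apply_right, Equiv.swap_apply_of_ne_of_ne]
  have : of R3 = (of R3 - of T1 - of Rr) + of T1 + (of Rr - of G1 - of G2') +
      (of G2' - of (G2'.reindex (Equiv.swap (0 : Fin 3) 1))) +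
      (of (G2'.reindex (Equiv.swap (0 : Fin 3) 1)) - of G2) + of T2 - (of T2 - of G1 - of G2) := by
    abel
  rw [this]
  exact relations.sub_mem (relations.add_mem (relations.add_mem (relations.add_mem
    (relations.add_mem (relations.add_mem a1 hT1r) a2) a3) a4) hT2r) a5

/-! ## From the cube to the item -/

/-- **The five-term integrand on the closed square is a KZ relation**: the slab
`[[0,1]³, abelF(c₀,c₁)] ∼ [[0,1]², abelF]` is one Newton–Leibniz move along the last coordinate
(primitive `c₂ · abelF(c₀,c₁)`). [Kontsevich–Zagier 2001, §1.2 rule (3)] -/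
theorem of_abelF_square_mem_relations {x y : ℝ} (hxa : IsAlgebraic ℚ x) (hya : IsAlgebraic ℚ y)
    (hx : 0 < x) (hy : 0 < y) (hxy : x + y < 1) :
    of (IntegralRep.tameCube (fun z : Fin 2 → ℝ => (x / ((1 - y) - x * (z 0) * (z 1)) + y / ((1 - x) - y * (z 0) * (z 1)) - x / (1 - x * (z 0) * (z 1)) - y / (1 - y * (z 0) * (z 1)) - x * y / ((1 - x) * (1 - y) - x * y * (z 0) * (z 1)) - x / (1 - x * (z 0)) * (y / (1 - y * (z 1))))) (an_abelF2 hx hy hxy)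
      (sa_abelF2 hxa hya)) ∈ relations := by
  have h3 := of_abelF_cube_mem_relations hxa hya hx hy hxy
  have hFa : AnalyticOnNhd ℝ (fun c : Fin 3 → ℝ => c 2 * (x / ((1 - y) - x * (c 0) * (c 1)) + y / ((1 - x) - y * (c 0) * (c 1)) - x / (1 - x * (c 0) * (c 1)) - y / (1 - y * (c 0) * (c 1)) - x * y / ((1 - x) * (1 - y) - x * y * (c 0) * (c 1)) - x / (1 - x * (c 0)) * (y / (1 - y * (c 1))))) (KZ.cube 3) :=
    fun z hz => an_mul (an_coord 2 z) (an_abelF3 hx hy hxy z hz)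
  have hFs : IsSemialgebraicFunOn ℚ (KZ.cube 3) (fun c : Fin 3 → ℝ => c 2 * (x / ((1 - y) - x * (c 0) * (c 1)) + y / ((1 - x) - y * (c 0) * (c 1)) - x / (1 - x * (c 0) * (c 1)) - y / (1 - y * (c 0) * (c 1)) - x * y / ((1 - x) * (1 - y) - x * y * (c 0) * (c 1)) - x / (1 - x * (c 0)) * (y / (1 - y * (c 1))))) :=
    (isSemialgebraicFunOn_apply KZ.isSemialgebraic_cube 2).fun_mul (sa_abelF3 hxa hya)
  have hslab : of (IntegralRep.tameCube (fun c : Fin 3 → ℝ => (x / ((1 - y) - x * (c 0) * (c 1)) + y / ((1 - x) - y * (c 0) * (c 1)) - x / (1 - x * (c 0) * (c 1)) - y / (1 - y * (c 0) * (c 1)) - x * y / ((1 - x) * (1 - y) - x * y * (c 0) * (c 1)) - x / (1 - x * (c 0)) * (y / (1 - y * (c 1)))))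
      (an_abelF3 hx hy hxy) (sa_abelF3 hxa hya)) -
      of (IntegralRep.tameCube (fun z : Fin 2 → ℝ => (x / ((1 - y) - x * (z 0) * (z 1)) + y / ((1 - x) - y * (z 0) * (z 1)) - x / (1 - x * (z 0) * (z 1)) - y / (1 - y * (z 0) * (z 1)) - x * y / ((1 - x) * (1 - y) - x * y * (z 0) * (z 1)) - x / (1 - x * (z 0)) * (y / (1 - y * (z 1))))) (an_abelF2 hx hy hxy)
      (sa_abelF2 hxa hya)) ∈ relations := by
    refine KZ.cubicalStokesGens_subset_relations (KZ.mem_cubicalStokesGens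
      (F := fun c : Fin 3 → ℝ => c 2 * (x / ((1 - y) - x * (c 0) * (c 1)) + y / ((1 - x) - y * (c 0) * (c 1)) - x / (1 - x * (c 0) * (c 1)) - y / (1 - y * (c 0) * (c 1)) - x * y / ((1 - x) * (1 - y) - x * y * (c 0) * (c 1)) - x / (1 - x * (c 0)) * (y / (1 - y * (c 1)))))
      (IntegralRep.isTameCube_tameCube _ _ _) (IntegralRep.isTameCube_tameCube _ _ _) hFa hFs
      (fun z _ t _ => ?_) (fun z _ => ?_))
    · simp only [IntegralRep.tameCube_integrand]
      exact ((hasDerivAt_id' t).mul_const ((x / ((1 - y) - x * (z 0) * (z 1)) + y / ((1 - x) - y * (z 0) * (z 1)) - x / (1 - x * (z 0) * (z 1)) - y / (1 - y * (z 0) * (z 1)) - x * y / ((1 - x) * (1 - y) - x * y * (z 0) * (z 1)) - x / (1 - x * (z 0)) * (y / (1 - y * (z 1)))))).congr_deriv (one_mul _)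
    · show (x / ((1 - y) - x * (z 0) * (z 1)) + y / ((1 - x) - y * (z 0) * (z 1)) - x / (1 - x * (z 0) * (z 1)) - y / (1 - y * (z 0) * (z 1)) - x * y / ((1 - x) * (1 - y) - x * y * (z 0) * (z 1)) - x / (1 - x * (z 0)) * (y / (1 - y * (z 1)))) = 1 * (x / ((1 - y) - x * (z 0) * (z 1)) + y / ((1 - x) - y * (z 0) * (z 1)) - x / (1 - x * (z 0) * (z 1)) - y / (1 - y * (z 0) * (z 1)) - x * y / ((1 - x) * (1 - y) - x * y * (z 0) * (z 1)) - x / (1 - x * (z 0)) * (y / (1 - y * (z 1)))) - 0 * (x / ((1 - y) - x * (z 0) * (z 1)) + y / ((1 - x) - y * (z 0) * (z 1)) - x / (1 - x * (z 0) * (z 1)) - y / (1 - y * (z 0) * (z 1)) - x * y / ((1 - x) * (1 - y) - x * y * (z 0) * (z 1)) - x / (1 - x * (z 0)) * (y / (1 - y * (z 1))))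
      ring
  have : of (IntegralRep.tameCube (fun z : Fin 2 → ℝ => (x / ((1 - y) - x * (z 0) * (z 1)) + y / ((1 - x) - y * (z 0) * (z 1)) - x / (1 - x * (z 0) * (z 1)) - y / (1 - y * (z 0) * (z 1)) - x * y / ((1 - x) * (1 - y) - x * y * (z 0) * (z 1)) - x / (1 - x * (z 0)) * (y / (1 - y * (z 1))))) (an_abelF2 hx hy hxy)
      (sa_abelF2 hxa hya)) = of (IntegralRep.tameCube (fun c : Fin 3 → ℝ => (x / ((1 - y) - x * (c 0) * (c 1)) + y / ((1 - x) - y * (c 0) * (c 1)) - x / (1 - x * (c 0) * (c 1)) - y / (1 - y * (c 0) * (c 1)) - x * y / ((1 - x) * (1 - y) - x * y * (c 0) * (c 1)) - x / (1 - x * (c 0)) * (y / (1 - y * (c 1)))))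
      (an_abelF3 hx hy hxy) (sa_abelF3 hxa hya)) - (of (IntegralRep.tameCube
      (fun c : Fin 3 → ℝ => (x / ((1 - y) - x * (c 0) * (c 1)) + y / ((1 - x) - y * (c 0) * (c 1)) - x / (1 - x * (c 0) * (c 1)) - y / (1 - y * (c 0) * (c 1)) - x * y / ((1 - x) * (1 - y) - x * y * (c 0) * (c 1)) - x / (1 - x * (c 0)) * (y / (1 - y * (c 1))))) (an_abelF3 hx hy hxy) (sa_abelF3 hxa hya)) -
      of (IntegralRep.tameCube (fun z : Fin 2 → ℝ => (x / ((1 - y) - x * (z 0) * (z 1)) + y / ((1 - x) - y * (z 0) * (z 1)) - x / (1 - x * (z 0) * (z 1)) - y / (1 - y * (z 0) * (z 1)) - x * y / ((1 - x) * (1 - y) - x * y * (z 0) * (z 1)) - x / (1 - x * (z 0)) * (y / (1 - y * (z 1))))) (an_abelF2 hx hy hxy)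
      (sa_abelF2 hxa hya))) := by abel
  rw [this]
  exact relations.sub_mem h3 hslab

/-- The open square has full measure in the closed square. [folklore] -/
theorem volume_cube_diff_openSquare :
    volume (KZ.cube 2 \ Set.pi Set.univ (fun _ : Fin 2 => Set.Ioo (0 : ℝ) 1)) = 0 := by
  have hsub : Set.pi Set.univ (fun _ : Fin 2 => Set.Ioo (0 : ℝ) 1) ⊆ KZ.cube 2 := fun z hz i =>
    ⟨(hz i (Set.mem_univ _)).1.le, (hz i (Set.mem_univ _)).2.le⟩
  have h1 : volume (Set.pi Set.univ (fun _ : Fin 2 => Set.Ioo (0 : ℝ) 1)) = 1 := by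
    rw [Real.volume_pi_Ioo]; simp
  rw [measure_sdiff hsub (MeasurableSet.univ_pi fun _ => measurableSet_Ioo).nullMeasurableSet
    (by simp [h1]), h1, KZ.volume_cube]
  simp

/-- **`FiveTermCertificate` holds**: Abel's five-term relation, for real algebraic
`0 < x, 0 < y, x + y < 1`, is certified inside `KZ.relations` by the Tate homotopy `x ↦ xw`, the
rational weight drop, two parametrised loop certificates, a slab move, removal of the null
boundary of the square, and agreement of the item's integrand with `abelF` on the open square.
[Zagier 2007, Ch. I §2; Kontsevich–Zagier 2001, §1.2] -/
theorem fiveTermCertificate_proof : FiveTermCertificate := by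
  intro x y hxa hya hx hy hxy r hdom heq
  set S : Set (Fin 2 → ℝ) := Set.pi Set.univ (fun _ : Fin 2 => Set.Ioo (0 : ℝ) 1) with hSdef
  set R2 := IntegralRep.tameCube (fun z : Fin 2 → ℝ => (x / ((1 - y) - x * (z 0) * (z 1)) + y / ((1 - x) - y * (z 0) * (z 1)) - x / (1 - x * (z 0) * (z 1)) - y / (1 - y * (z 0) * (z 1)) - x * y / ((1 - x) * (1 - y) - x * y * (z 0) * (z 1)) - x / (1 - x * (z 0)) * (y / (1 - y * (z 1))))) (an_abelF2 hx hy hxy)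
    (sa_abelF2 hxa hya) with hR2
  have h2 : of R2 ∈ relations := of_abelF_square_mem_relations hxa hya hx hy hxy
  have hSsa : IsSemialgebraic ℚ S := hdom ▸ r.isSemialgebraic_domain
  have hSsub : S ⊆ R2.domain := fun z hz i =>
    ⟨(hz i (Set.mem_univ _)).1.le, (hz i (Set.mem_univ _)).2.le⟩
  have hres : of R2 - of (R2.restrict S hSsa hSsub) ∈ relations :=
    R2.of_sub_of_restrict_mem_relations hSsa hSsub volume_cube_diff_openSquare
  have heqv : of (R2.restrict S hSsa hSsub) - of r ∈ relations := by
    refine of_sub_of_mem_relations_of_eqOn (by rw [IntegralRep.domain_restrict, hdom]) fun z hz => ?_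
    have hz' : z ∈ r.domain := by rw [hdom]; exact hz
    have hz0 : z 0 ∈ Icc (0 : ℝ) 1 := ⟨(hz 0 (Set.mem_univ _)).1.le, (hz 0 (Set.mem_univ _)).2.le⟩
    have hz1 : z 1 ∈ Icc (0 : ℝ) 1 := ⟨(hz 1 (Set.mem_univ _)).1.le, (hz 1 (Set.mem_univ _)).2.le⟩
    obtain ⟨f01, f02, f03, f04, f05, f06, f07, f08, f09, f10, f11, f12, f13, f14, f15, f16, f17, f18,
      f19, f20, f21, f22, f23, f24, f25⟩ := facts hx hy hxy hz0 hz1 hz1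
    rw [IntegralRep.integrand_restrict, hR2, IntegralRep.tameCube_integrand, heq hz']
    exact (route_integrand_eq_abelF x y (z 0) (z 1) f01.ne' f02.ne' f21.ne' f22.ne' f24.ne').symm
  have : of r = of R2 - (of R2 - of (R2.restrict S hSsa hSsub)) -
      (of (R2.restrict S hSsa hSsub) - of r) := by abel
  rw [this]
  exact relations.sub_mem (relations.sub_mem h2 hres) heqv

end Summit.KontsevichZagierPeriods.InverseLandau.FiveTerm
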